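import Mathlib
import HarnessLib
import Summits.NavierStokesRegularity.NavierStokesRegularity.Theorems.TypeIQuarterGateScarEnvelopeTypeIForcedTsaiDefs

/-!
# ARM B, lane E-exact — CERTIFICATE ROWS for `ForcedTsaiModulusLE`: polynomial × Gaussian witnesses,
  exact Gaussian moments (ns-wall-extremal PREREG-WALL-1 A1 §B2(d), exp-lead «E-exact GO» 16:10:33Z)

ROW OF RECORD (`WitnessRow`): `{s, p, M, δ}` with `s ∈ ℚ₊` (Gaussian rate `a := s²`), `p` = three sparse
polynomials in `ℚ[y₁,y₂,y₃]` (lists of monomials `⟨e₁,e₂,e₃,c⟩`), claimed level floor `M` and residual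
ceiling `δ`.  The WITNESS is the vector potential `Ψ(y) = p(y)·e^{−a|y|²}` and the field `U := curl Ψ`
(divergence-free by construction; smooth; Gaussian tails).

EXACT PIPELINE (all in `ℚ`, kernel-replayable; mirror `pub-ns-dss/wall-extremal/arm-B/gausscert.py`):
with the rate-`b` coefficient derivative `D_b,j q := ∂_j q − 2b·y_j·q` (so that `∂_j(q e^{−b|y|²}) =
(D_b,j q) e^{−b|y|²}`): `u := curl_a p` (`U = u·G`, `G = e^{−a|y|²}`), `ω := curl_a u` (`curl U = ω·G`),
`f := −Σ_j D_a,j D_a,j u + ½u + ½Σ_j y_j D_a,j u` (`−ΔU + ½U + ½y·∇U = f·G`), `n_i := Σ_j u_j·D_a,j u_i`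
(`(U·∇)U = n·G²`), `g₁ := curl_a f`, `g₂ := curl_{2a} n` (vorticity residual `g = g₁G + g₂G²`).
MOMENTS: `∫_{ℝ³} y^α e^{−b|y|²}dy = Π_i μ(α_i,b)·(π/b)^{3/2}`, `μ(2k,b) = (2k−1)!!/(2b)^k`, `μ(odd) = 0`.
  `R_L := ∫(1 − |y|²/100)|ω|²G² /(π/2a)^{3/2}`,  `R₂ := ∫m|g₁|²G² /(π/2a)^{3/2}`,
  `R₃ := 2∫m g₁·g₂ G³ /(π/3a)^{3/2}`,  `R₄ := ∫m|g₂|²G⁴ /(π/4a)^{3/2}`,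
with the even majorant `m(t) = 7/2 + 35t/2 + 21t²/2 + t³/2 ≥ (1+√t)⁵` (`t = |y|²`).
CHECK: `0 < s`, `0 ≤ M`, `0 ≤ δ`, `M² ≤ R_L·π₋^{3/2}·c₂₋/s³` (if `R_L ≥ 0`) and
`(π₊^{3/2}/s³)(R₂c₂₊ + R₃c₃± + R₄/8) ≤ δ²`, with fixed two-sided rational enclosures `π∓^{3/2}` of
`π^{3/2}`, `c₂∓` of `2^{−3/2}`, `c₃∓` of `3^{−3/2}` (sign-aware for `R₃`).
WHY THIS CERTIFIES `ForcedTsaiModulusLE M δ`: `‖curl U‖²_{L²(B₁₀)} ≥ ∫(1−|y|²/100)|curl U|²`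
(integrand `≤ |curl U|²·𝟙_{B₁₀}` pointwise) and `‖(1+ρ)^{5/2}g‖² ≤ ∫ m(ρ²)|g|²`.  The kernel
SOUNDNESS theorem `WitnessRow.sound : r.check = true → ForcedTsaiModulusLE r.M r.δ` (real-analysis
of the explicit field: smoothness, `div curl = 0`, the `ℝ³` Gaussian-moment identity, the two majorants)
is NOT in this file — it lands separately once stub-free; until then a passing row is a kernel-REPLAYED
exact computation whose meaning is the displayed inequalities on `R_L, R₂, R₃, R₄`.

HONEST FRAMING: an upper bound on the forced-Tsai modulus («near-profiles this good exist»), never an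
exclusion; MODEL/certificate-level; nothing here bears on Navier–Stokes regularity; 23843 / H3 OPEN.
-/

set_option linter.dupNamespace false

namespace Summit.NavierStokesRegularity.NavierStokesRegularity.Cruxes.ScarEnvelopeTypeI.ForcedTsai

/-! ## Sparse polynomials over `ℚ` in three variables -/

/-- A monomial `c · y₁^e₁ y₂^e₂ y₃^e₃`. -/
structure Mono where
  /-- exponent of `y₁` -/ e1 : ℕ
  /-- exponent of `y₂` -/ e2 : ℕ
  /-- exponent of `y₃` -/ e3 : ℕ
  /-- coefficient -/ c : ℚ
  deriving DecidableEq, Repr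

/-- A sparse polynomial = a list of monomials (its value is the SUM; duplicates allowed). -/
abbrev QPoly := List Mono

namespace Mono

/-- Exponent of variable `j`. -/
def exp (m : Mono) (j : Fin 3) : ℕ := match j with | 0 => m.e1 | 1 => m.e2 | 2 => m.e3

/-- Lexicographic key. -/
def key (m : Mono) : ℕ × ℕ × ℕ := (m.e1, m.e2, m.e3)

/-- Product of monomials. -/
def mul (m m' : Mono) : Mono := ⟨m.e1 + m'.e1, m.e2 + m'.e2, m.e3 + m'.e3, m.c * m'.c⟩

/-- Multiply by `y_j`. -/
def mulVar (j : Fin 3) (m : Mono) : Mono :=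
  match j with
  | 0 => { m with e1 := m.e1 + 1 }
  | 1 => { m with e2 := m.e2 + 1 }
  | 2 => { m with e3 := m.e3 + 1 }

/-- `∂_j` of a monomial (`none` if the variable is absent). -/
def deriv (j : Fin 3) (m : Mono) : Option Mono :=
  match j with
  | 0 => if m.e1 = 0 then none else some { m with e1 := m.e1 - 1, c := m.c * m.e1 }
  | 1 => if m.e2 = 0 then none else some { m with e2 := m.e2 - 1, c := m.c * m.e2 }
  | 2 => if m.e3 = 0 then none else some { m with e3 := m.e3 - 1, c := m.c * m.e3 }

end Mono

namespace QPoly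

/-- Sum. -/
def add (P Q : QPoly) : QPoly := P ++ Q

/-- Scalar multiple. -/
def scale (c : ℚ) (P : QPoly) : QPoly := P.map fun m => { m with c := c * m.c }

/-- Difference. -/
def sub (P Q : QPoly) : QPoly := add P (scale (-1) Q)

/-- Multiply by `y_j`. -/
def mulVar (j : Fin 3) (P : QPoly) : QPoly := P.map (Mono.mulVar j)

/-- Partial derivative `∂_j`. -/
def deriv (j : Fin 3) (P : QPoly) : QPoly := P.filterMap (Mono.deriv j)

/-- Product (unnormalised). -/
def mul (P Q : QPoly) : QPoly := P.flatMap fun m => Q.map (Mono.mul m)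

/-- Combine ADJACENT monomials with equal exponents (after sorting) and drop zeros. -/
def combine : QPoly → QPoly
  | [] => []
  | [m] => if m.c = 0 then [] else [m]
  | m :: m' :: rest =>
    if m.key = m'.key then combine ({ m with c := m.c + m'.c } :: rest)
    else if m.c = 0 then combine (m' :: rest) else m :: combine (m' :: rest)
  termination_by P => P.length

/-- Lexicographic order on keys as a Boolean. -/
def keyLE (m m' : Mono) : Bool :=
  decide (m.e1 < m'.e1 ∨ (m.e1 = m'.e1 ∧ (m.e2 < m'.e2 ∨ (m.e2 = m'.e2 ∧ m.e3 ≤ m'.e3))))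

/-- Normal form: sort by exponents, combine like terms (value-preserving). -/
def norm (P : QPoly) : QPoly := combine (P.mergeSort keyLE)

/-- Normalised product. -/
def nmul (P Q : QPoly) : QPoly := norm (mul P Q)

end QPoly

/-! ## The Gaussian pipeline (coefficient level) -/

/-- Rate-`b` coefficient derivative: `∂_j (q e^{−b|y|²}) = (∂_j q − 2b y_j q) e^{−b|y|²}`. -/
def Dg (b : ℚ) (j : Fin 3) (P : QPoly) : QPoly :=
  QPoly.add (QPoly.deriv j P) (QPoly.scale (-2 * b) (QPoly.mulVar j P))

/-- Coefficient-level curl at Gaussian rate `b`. -/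
def curlG (b : ℚ) (V : Fin 3 → QPoly) : Fin 3 → QPoly :=
  ![QPoly.norm (QPoly.sub (Dg b 1 (V 2)) (Dg b 2 (V 1))),
    QPoly.norm (QPoly.sub (Dg b 2 (V 0)) (Dg b 0 (V 2))),
    QPoly.norm (QPoly.sub (Dg b 0 (V 1)) (Dg b 1 (V 0)))]

/-- `f = −Σ_j D D u + ½ u + ½ Σ_j y_j D u` (coefficients of `−ΔU + ½U + ½y·∇U` at rate `a`). -/
def linPart (a : ℚ) (u : Fin 3 → QPoly) : Fin 3 → QPoly := fun i =>
  let lap := QPoly.add (QPoly.add (Dg a 0 (Dg a 0 (u i))) (Dg a 1 (Dg a 1 (u i)))) (Dg a 2 (Dg a 2 (u i)))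
  let ydu := QPoly.add (QPoly.add (QPoly.mulVar 0 (Dg a 0 (u i))) (QPoly.mulVar 1 (Dg a 1 (u i))))
    (QPoly.mulVar 2 (Dg a 2 (u i)))
  QPoly.norm (QPoly.add (QPoly.add (QPoly.scale (-1) lap) (QPoly.scale (1 / 2) (u i)))
    (QPoly.scale (1 / 2) ydu))

/-- `n_i = Σ_j u_j · D_{a,j} u_i` (coefficients of `(U·∇)U` at rate `2a`). -/
def nlPart (a : ℚ) (u : Fin 3 → QPoly) : Fin 3 → QPoly := fun i =>
  QPoly.norm (QPoly.add (QPoly.add (QPoly.mul (u 0) (Dg a 0 (u i))) (QPoly.mul (u 1) (Dg a 1 (u i))))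
    (QPoly.mul (u 2) (Dg a 2 (u i))))

/-! ## Exact Gaussian moments -/

/-- `μ(n, b) = ∫_ℝ x^n e^{−bx²} dx / √(π/b)`: `0` for odd `n`, `(n−1)!!/(2b)^{n/2}` for even `n`. -/
def mom1 (n : ℕ) (b : ℚ) : ℚ :=
  if n % 2 = 1 then 0 else (List.range (n / 2)).foldl (fun acc i => acc * ((2 * (i : ℚ) + 1) / (2 * b))) 1

/-- `∫_{ℝ³} y^α e^{−b|y|²} dy / (π/b)^{3/2}`. -/
def mom3 (e1 e2 e3 : ℕ) (b : ℚ) : ℚ := mom1 e1 b * mom1 e2 b * mom1 e3 b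

/-- `∫ (P·Q)(y) e^{−b|y|²} dy / (π/b)^{3/2}`, streamed over monomial pairs. -/
def pairPoly (P Q : QPoly) (b : ℚ) : ℚ :=
  P.foldl (fun acc m => Q.foldl (fun acc' m' =>
    acc' + m.c * m'.c * mom3 (m.e1 + m'.e1) (m.e2 + m'.e2) (m.e3 + m'.e3) b) acc) 0

/-- `∫ W(y)·(V·V')(y) e^{−b|y|²} dy / (π/b)^{3/2}` for vector polynomials and a weight polynomial `W`. -/
def pairVec (W : QPoly) (V V' : Fin 3 → QPoly) (b : ℚ) : ℚ :=
  pairPoly (QPoly.nmul W (V 0)) (V' 0) b + pairPoly (QPoly.nmul W (V 1)) (V' 1) b +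
    pairPoly (QPoly.nmul W (V 2)) (V' 2) b

/-- `t = |y|²` as a polynomial. -/
def tPoly : QPoly := [⟨2, 0, 0, 1⟩, ⟨0, 2, 0, 1⟩, ⟨0, 0, 2, 1⟩]

/-- Level weight `1 − |y|²/100` (`≤ 𝟙_{B₁₀}` where the integrand is non-negative). -/
def wLevel : QPoly := [⟨0, 0, 0, 1⟩, ⟨2, 0, 0, -1 / 100⟩, ⟨0, 2, 0, -1 / 100⟩, ⟨0, 0, 2, -1 / 100⟩]

/-- Residual weight `m(|y|²) = 7/2 + 35t/2 + 21t²/2 + t³/2 ≥ (1+|y|)⁵` (`t = y₁²+y₂²+y₃²`), written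
out as its 20 monomials (so that its real value unfolds by `simp`; a native `example` below checks it against the
symbolic expansion by a native `example`). -/
def wResid : QPoly :=
  [⟨0, 0, 0, 7 / 2⟩,
   ⟨2, 0, 0, 35 / 2⟩, ⟨0, 2, 0, 35 / 2⟩, ⟨0, 0, 2, 35 / 2⟩,
   ⟨4, 0, 0, 21 / 2⟩, ⟨0, 4, 0, 21 / 2⟩, ⟨0, 0, 4, 21 / 2⟩, ⟨2, 2, 0, 21⟩, ⟨2, 0, 2, 21⟩, ⟨0, 2, 2, 21⟩,
   ⟨6, 0, 0, 1 / 2⟩, ⟨0, 6, 0, 1 / 2⟩, ⟨0, 0, 6, 1 / 2⟩, ⟨4, 2, 0, 3 / 2⟩, ⟨4, 0, 2, 3 / 2⟩, ⟨2, 4, 0, 3 / 2⟩,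
   ⟨0, 4, 2, 3 / 2⟩, ⟨2, 0, 4, 3 / 2⟩, ⟨0, 2, 4, 3 / 2⟩, ⟨2, 2, 2, 3⟩]

/-- Consistency (native): the written-out weight equals the normal form of `7/2 + 35t/2 + 21t²/2 + t³/2`. -/
example : QPoly.norm wResid =
    QPoly.norm (QPoly.add (QPoly.add (QPoly.add [⟨0, 0, 0, 7 / 2⟩] (QPoly.scale (35 / 2) tPoly))
      (QPoly.scale (21 / 2) (QPoly.mul tPoly tPoly)))
      (QPoly.scale (1 / 2) (QPoly.mul tPoly (QPoly.mul tPoly tPoly)))) := by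
  native_decide

/-! ## Rows, the four exact numbers, the check -/

/-- An E-exact WITNESS ROW: Gaussian rate `a = s²`, vector-potential polynomials `p`, claimed level
floor `M` and residual ceiling `δ`. -/
structure WitnessRow where
  /-- square root of the Gaussian rate (`a = s²`, so that `a^{3/2} = s³` is rational) -/ s : ℚ
  /-- the three components of the polynomial vector potential -/ p : Fin 3 → QPoly
  /-- claimed level floor `M ≤ ‖curl U‖_{L²(B₁₀)}` -/ M : ℚ
  /-- claimed residual ceiling `‖(1+ρ)^{5/2} g‖_{L²} ≤ δ` -/ δ : ℚ

namespace WitnessRow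

/-- Gaussian rate `a = s²`. -/
def a (r : WitnessRow) : ℚ := r.s * r.s
/-- `u`: `U = curl Ψ = u·e^{−a|y|²}`. -/
def u (r : WitnessRow) : Fin 3 → QPoly := curlG r.a r.p
/-- `ω`: `curl U = ω·e^{−a|y|²}`. -/
def om (r : WitnessRow) : Fin 3 → QPoly := curlG r.a r.u
/-- `g₁ = curl_a f`. -/
def g1 (r : WitnessRow) : Fin 3 → QPoly := curlG r.a (linPart r.a r.u)
/-- `g₂ = curl_{2a} n`. -/
def g2 (r : WitnessRow) : Fin 3 → QPoly := curlG (2 * r.a) (nlPart r.a r.u)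
/-- `R_L`. -/
def RL (r : WitnessRow) : ℚ := pairVec wLevel r.om r.om (2 * r.a)
/-- `R₂`. -/
def R2 (r : WitnessRow) : ℚ := pairVec wResid r.g1 r.g1 (2 * r.a)
/-- `R₃`. -/
def R3 (r : WitnessRow) : ℚ := 2 * pairVec wResid r.g1 r.g2 (3 * r.a)
/-- `R₄`. -/
def R4 (r : WitnessRow) : ℚ := pairVec wResid r.g2 r.g2 (4 * r.a)

end WitnessRow

/-- Rational enclosure `π₋^{3/2} ≤ π^{3/2} ≤ π₊^{3/2}` (`π^{3/2} = 5.568327996…`). -/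
def pi32Lo : ℚ := 55683279 / 10 ^ 7
/-- see `pi32Lo` -/
def pi32Hi : ℚ := 55683280 / 10 ^ 7
/-- Rational enclosure of `2^{−3/2} = 0.353553390…`. -/
def c2Lo : ℚ := 35355339 / 10 ^ 8
/-- see `c2Lo` -/
def c2Hi : ℚ := 35355340 / 10 ^ 8
/-- Rational enclosure of `3^{−3/2} = 0.192450089…`. -/
def c3Lo : ℚ := 19245008 / 10 ^ 8
/-- see `c3Lo` -/
def c3Hi : ℚ := 19245010 / 10 ^ 8

namespace WitnessRow

/-- Certified lower bound of `level² = ‖curl U‖²_{L²(B₁₀)}` (zero if `R_L < 0`). -/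
def lev2Lo (r : WitnessRow) : ℚ := if 0 ≤ r.RL then r.RL * pi32Lo * c2Lo / r.s ^ 3 else 0

/-- Certified upper bound of `residual² = ‖(1+ρ)^{5/2} g‖²_{L²}`. -/
def res2Hi (r : WitnessRow) : ℚ :=
  (pi32Hi / r.s ^ 3) * (r.R2 * c2Hi + (if 0 ≤ r.R3 then r.R3 * c3Hi else r.R3 * c3Lo) + r.R4 / 8)

/-- **The total Boolean check of a witness row** (exact rational arithmetic). -/
def check (r : WitnessRow) : Bool :=
  decide (0 < r.s) && decide (0 ≤ r.M) && decide (0 ≤ r.δ) &&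
    decide (r.M * r.M ≤ r.lev2Lo) && decide (r.res2Hi ≤ r.δ * r.δ)

end WitnessRow

/-- A table of witness rows (one data module per certification pass). -/
abbrev WitnessTable := List WitnessRow

/-- Every row passes. -/
def WitnessTable.check (T : WitnessTable) : Bool := T.all WitnessRow.check

/-- Self-test (kernel): the toy potential `Ψ = e₃·e^{−|y|²/4}` (`s = 1/2`) — a Gaussian swirl, far
from a near-profile — has certified level `≥ 3` and certified residual `≤ 214` (ratio ≈ 70). -/
example : (WitnessRow.mk (1 / 2) ![[], [], [⟨0, 0, 0, 1⟩]] 3 214).check = true := by native_decide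

end Summit.NavierStokesRegularity.NavierStokesRegularity.Cruxes.ScarEnvelopeTypeI.ForcedTsai
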